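import Summits.NavierStokesRegularity.NavierStokesRegularity.Theorems.TypeICertificateLadderTargetRotatingConjugateDensityWeak
import Literature.Analysis.FluidPDE.PineauVicolWeightPositivity
import HarnessLib

/-!
# The smooth classical solution of the twisted weight equation
# (tools for the rotating conjugate density, stub B2 of line `killing-twisted-bernoulli-solitons`,
# crux `Target`, stmt-NavierStokesRegularity-1217)

Helper file (all results proved, no definitions, no named facts). Rotating-gauge version of the
regularity step `F4` of the tree's `PineauVicolWeightPositivity` (Pineau–Vicol 2026, Prop. 5.1,
arXiv:2607.09619): the twisted weak solution of
`TypeICertificateLadderTargetRotatingConjugateDensityWeak` (`exists_weak_solution_fun_rot`, drift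
`U + ½y − J y`, `J` skew linear) is a distributional solution of
`Δ(γf) + div((γf)(½y + U − Jy)) = 0` (`integral_mul_transpose_eq_zero_rot`: the only change
w.r.t. the tree is the test field `Ψ₃ = φ J`, bounded because `φ` has compact support, which
converts the rotation term `∫γ⟪Jy, G⟫φ` into `−∫γ f ⟪Jy, ∇φ⟫`); the operator is the transpose
of the Hörmander operator `Σ ∂ⱼ² + X₀ + div X₀` with the smooth drift `X₀ = ½y + U − Jy`
(`exists_contDiff_ae_eq_rot`, through the tree's `hormander1967_thm11_proof` — drift-generic), so
`γ f` agrees a.e. with a smooth function and the equation holds classically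
(`exists_smooth_solution_rot`: `v ∈ C^∞`, `v ≢ 0`, `v, ∇v ∈ L²(γ)`, `γ|y|²v²` integrable,
`Δ(γv) + div((γv)(½y + U − Jy)) = 0`). Registered `ℝ³` form: `rotatingDensity_smoothSolution`
(`J = α rotGen`).

References: B. Pineau, V. Vicol, arXiv:2607.09619 (2026), Prop. 5.1, (5.1)–(5.2), Remark 5.2;
L. Hörmander, Acta Math. 119 (1967), Thm. 1.1.
-/

noncomputable section

open MeasureTheory TopologicalSpace Set Function Filter Topology InnerProductSpace Real
open scoped RealInnerProductSpace ENNReal NNReal ContDiff Distributions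

namespace Summit.NavierStokesRegularity.NavierStokesRegularity.Theorems

open Literature.Analysis.FluidPDE Literature.Analysis.FluidPDE.PineauVicol2026
open Literature.Analysis.Distribution
open scoped Laplacian

variable {E : Type} [NormedAddCommGroup E] [InnerProductSpace ℝ E] [FiniteDimensional ℝ E]
  [MeasurableSpace E] [BorelSpace E]

variable {U : E → E} {C₀ : ℝ}

/-- **The distributional equation, rotating gauge.** If `f ∈ L²(γ)` has the `γ`-weak gradient `G`
and the pair satisfies the twisted weak equation
`∫γ⟪G,∇φ⟫ − ∫γ⟪U,G⟫φ + ∫γ⟪Jy,G⟫φ + ∫γ ½⟪U,y⟫ f φ = 0` (`J` skew), then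
`∫ (γ f) (Δφ − Dφ[½y + U − Jy]) dy = 0` for every test function `φ`: `u = γ f` is a distributional
solution of `Δu + div(u (½y + U − Jy)) = 0`. [cite: PineauVicol2026, (5.1)–(5.2) and Remark 5.2] -/
theorem integral_mul_transpose_eq_zero_rot (h : DriftHyp U C₀) {J : E →L[ℝ] E} (hJ : ∀ v, ⟪J v, v⟫ = 0)
    {f : E → ℝ} {G : E → E} (hf : MemLp f 2 (gaussMeasure (E := E)))
    (hgrad : ∀ (Ψ : E → E) (C : ℝ), ContDiff ℝ 1 Ψ → (∀ y, ‖Ψ y‖ ≤ C) →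
      (∀ y, |VectorCalculus.divergence Ψ y| ≤ C) →
        ∫ y, gaussWeight y * ⟪G y, Ψ y⟫ =
          -∫ y, gaussWeight y * (f y * (VectorCalculus.divergence Ψ y - ⟪Ψ y, y⟫ / 2)))
    (hweak : ∀ φ : E → ℝ, ContDiff ℝ ∞ φ → HasCompactSupport φ →
      (∫ y, gaussWeight y * ⟪G y, gradient φ y⟫) - (∫ y, gaussWeight y * (⟪U y, G y⟫ * φ y)) +
        (∫ y, gaussWeight y * (⟪J y, G y⟫ * φ y)) +
        (∫ y, gaussWeight y * (⟪U y, y⟫ / 2 * f y * φ y)) = 0)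
    (φ : E → ℝ) (hφ : ContDiff ℝ ∞ φ) (hφc : HasCompactSupport φ) :
    ∫ y, (gaussWeight y * f y) * ((Δ φ) y - fderiv ℝ φ y ((1 / 2 : ℝ) • y + U y - J y)) = 0 := by
  have hφ2 : ContDiff ℝ 2 φ := hφ.of_le (by norm_cast)
  have hφ1 : ContDiff ℝ 1 φ := hφ.of_le (by norm_cast)
  have hgφ : ContDiff ℝ 1 (gradient φ) := PineauVicol2026.contDiff_gradient (n := 1) (hφ.of_le (by norm_cast))
  have hgc : HasCompactSupport (gradient φ) := PineauVicol2026.hasCompactSupport_gradient hφc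
  obtain ⟨C₁, hC₁⟩ := exists_bound_of_hasCompactSupport hgφ.continuous hgc
  have hΔc : Continuous (Δ φ) := continuous_laplacian hφ2
  obtain ⟨C₂, hC₂⟩ := exists_bound_of_hasCompactSupport hΔc (hasCompactSupport_laplacian hφc)
  obtain ⟨C₃, hC₃⟩ := exists_bound_of_hasCompactSupport hφ.continuous hφc
  have hC₃0 : 0 ≤ C₃ := (norm_nonneg _).trans (hC₃ 0)
  have hC₀ := h.nonneg
  -- `Ψ₁ = ∇φ`
  have hdiv1 : ∀ y, VectorCalculus.divergence (gradient φ) y = (Δ φ) y := PineauVicol2026.divergence_gradient hφ2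
  have e1 := hgrad (gradient φ) (max C₁ C₂) hgφ (fun y => (hC₁ y).trans (le_max_left _ _))
    (fun y => by rw [hdiv1, ← Real.norm_eq_abs]; exact (hC₂ y).trans (le_max_right _ _))
  -- `Ψ₂ = φ U`
  have hΨ2 : ContDiff ℝ 1 (fun y => φ y • U y) := hφ1.smul h.contDiff_one
  have hdiv2 : ∀ y, VectorCalculus.divergence (fun y => φ y • U y) y = ⟪U y, gradient φ y⟫ := by
    intro y
    rw [divergence_smul_apply (hφ1.differentiable one_ne_zero y)
      (h.contDiff_one.differentiable one_ne_zero y), h.div_eq_zero, mul_zero, zero_add]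
  have hb2 : ∀ y, ‖φ y • U y‖ ≤ C₃ * C₀ := fun y => by
    rw [norm_smul]; exact mul_le_mul (hC₃ y) (h.norm_le y) (norm_nonneg _) hC₃0
  have hdb2 : ∀ y, |VectorCalculus.divergence (fun y => φ y • U y) y| ≤ C₀ * C₁ := fun y => by
    rw [hdiv2]
    exact (abs_real_inner_le_norm _ _).trans (mul_le_mul (h.norm_le y) (hC₁ y) (norm_nonneg _) hC₀)
  have e2 := hgrad (fun y => φ y • U y) (max (C₃ * C₀) (C₀ * C₁)) hΨ2
    (fun y => (hb2 y).trans (le_max_left _ _)) (fun y => (hdb2 y).trans (le_max_right _ _))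
  -- `Ψ₃ = φ J` (bounded since `φ` has compact support; `div (φ J) = ⟪J y, ∇φ⟫`)
  have hJ1 : ContDiff ℝ 1 (J : E → E) := J.contDiff
  have hΨ3 : ContDiff ℝ 1 (fun y => φ y • J y) := hφ1.smul hJ1
  have hdiv3 : ∀ y, VectorCalculus.divergence (fun y => φ y • J y) y = ⟪J y, gradient φ y⟫ := by
    intro y
    rw [divergence_smul_apply (hφ1.differentiable one_ne_zero y) (hJ1.differentiable one_ne_zero y),
      divergence_eq_zero_of_skew hJ, mul_zero, zero_add]
  have hΨ3c : HasCompactSupport (fun y => φ y • J y) := hφc.smul_right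
  obtain ⟨C₄, hC₄⟩ := exists_bound_of_hasCompactSupport hΨ3.continuous hΨ3c
  have hdiv3c : Continuous fun y => ⟪J y, gradient φ y⟫ := J.continuous.inner hgφ.continuous
  have hdiv3s : HasCompactSupport fun y => ⟪J y, gradient φ y⟫ := by
    refine hasCompactSupport_of_eq_zero hφc fun y hy => ?_
    simp only [gradient_eq_zero_of_notMem_tsupport hy, inner_zero_right]
  obtain ⟨C₅, hC₅⟩ := exists_bound_of_hasCompactSupport hdiv3c hdiv3s
  have e4 := hgrad (fun y => φ y • J y) (max C₄ C₅) hΨ3 (fun y => (hC₄ y).trans (le_max_left _ _))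
    (fun y => by rw [hdiv3, ← Real.norm_eq_abs]; exact (hC₅ y).trans (le_max_right _ _))
  have e3 := hweak φ hφ hφc
  have r1 : ∫ y, gaussWeight y * (⟪U y, G y⟫ * φ y) = ∫ y, gaussWeight y * ⟪G y, φ y • U y⟫ := by
    refine integral_congr_ae (Eventually.of_forall fun y => ?_)
    dsimp only
    rw [real_inner_smul_right, real_inner_comm]
    ring
  have r2 : ∫ y, gaussWeight y * (⟪J y, G y⟫ * φ y) = ∫ y, gaussWeight y * ⟪G y, φ y • J y⟫ := by
    refine integral_congr_ae (Eventually.of_forall fun y => ?_)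
    dsimp only
    rw [real_inner_smul_right, real_inner_comm]
    ring
  rw [r1, r2, e1, e2, e4] at e3
  simp only [hdiv1, hdiv2, hdiv3] at e3
  -- the four bounded compactly supported multipliers
  set g₁ : E → ℝ := fun y => (Δ φ) y - ⟪gradient φ y, y⟫ / 2 with hg₁
  set g₂ : E → ℝ := fun y => ⟪U y, gradient φ y⟫ - ⟪φ y • U y, y⟫ / 2 with hg₂
  set g₃ : E → ℝ := fun y => ⟪U y, y⟫ / 2 * φ y with hg₃
  set g₄ : E → ℝ := fun y => ⟪J y, gradient φ y⟫ with hg₄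
  have hg₁c : Continuous g₁ := hΔc.sub ((hgφ.continuous.inner continuous_id).div_const 2)
  have hg₂c : Continuous g₂ := (h.continuous.inner hgφ.continuous).sub
    (((hφ.continuous.smul h.continuous).inner continuous_id).div_const 2)
  have hg₃c : Continuous g₃ := ((h.continuous.inner continuous_id).div_const 2).mul hφ.continuous
  have hg₁s : HasCompactSupport g₁ := by
    refine hasCompactSupport_of_eq_zero hφc fun y hy => ?_
    simp only [hg₁, laplacian_eq_zero_of_notMem_tsupport hy, gradient_eq_zero_of_notMem_tsupport hy,
      inner_zero_left, zero_div, sub_zero]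
  have hg₂s : HasCompactSupport g₂ := by
    refine hasCompactSupport_of_eq_zero hφc fun y hy => ?_
    simp only [hg₂, gradient_eq_zero_of_notMem_tsupport hy, image_eq_zero_of_notMem_tsupport hy,
      inner_zero_right, zero_smul, inner_zero_left, zero_div, sub_zero]
  have hg₃s : HasCompactSupport g₃ := by
    refine hasCompactSupport_of_eq_zero hφc fun y hy => ?_
    simp only [hg₃, image_eq_zero_of_notMem_tsupport hy, mul_zero]
  obtain ⟨K₁, hK₁⟩ := exists_bound_of_hasCompactSupport hg₁c hg₁s
  obtain ⟨K₂, hK₂⟩ := exists_bound_of_hasCompactSupport hg₂c hg₂s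
  obtain ⟨K₃, hK₃⟩ := exists_bound_of_hasCompactSupport hg₃c hg₃s
  have i1 := integrable_gaussWeight_mul_mul_of_bound hf hg₁c hK₁
  have i2 := integrable_gaussWeight_mul_mul_of_bound hf hg₂c hK₂
  have i3 := integrable_gaussWeight_mul_mul_of_bound hf hg₃c hK₃
  have i4 := integrable_gaussWeight_mul_mul_of_bound hf hdiv3c hC₅
  -- rewrite `e3` with the multipliers
  have s1 : ∫ y, gaussWeight y * (f y * ((Δ φ) y - ⟪gradient φ y, y⟫ / 2)) = ∫ y, gaussWeight y * f y * g₁ y :=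
    integral_congr_ae (Eventually.of_forall fun y => by simp only [hg₁]; ring)
  have s2 : ∫ y, gaussWeight y * (f y * (⟪U y, gradient φ y⟫ - ⟪φ y • U y, y⟫ / 2)) =
      ∫ y, gaussWeight y * f y * g₂ y :=
    integral_congr_ae (Eventually.of_forall fun y => by simp only [hg₂]; ring)
  have s3 : ∫ y, gaussWeight y * (⟪U y, y⟫ / 2 * f y * φ y) = ∫ y, gaussWeight y * f y * g₃ y :=
    integral_congr_ae (Eventually.of_forall fun y => by simp only [hg₃]; ring)
  have s4 : ∫ y, gaussWeight y * (f y * (⟪J y, gradient φ y⟫ - ⟪φ y • J y, y⟫ / 2)) =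
      ∫ y, gaussWeight y * f y * g₄ y :=
    integral_congr_ae (Eventually.of_forall fun y => by
      simp only [hg₄, real_inner_smul_left, hJ y, mul_zero, zero_div, sub_zero]; ring)
  rw [s1, s2, s3, s4] at e3
  -- the target integrand is `γ f (g₁ − g₂ − g₃ + g₄)`
  have st : ∫ y, (gaussWeight y * f y) * ((Δ φ) y - fderiv ℝ φ y ((1 / 2 : ℝ) • y + U y - J y)) =
      ∫ y, ((gaussWeight y * f y * g₁ y - gaussWeight y * f y * g₂ y) - gaussWeight y * f y * g₃ y) +
        gaussWeight y * f y * g₄ y := by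
    refine integral_congr_ae (Eventually.of_forall fun y => ?_)
    simp only [hg₁, hg₂, hg₃, hg₄]
    rw [← inner_gradient_left, inner_sub_right, inner_add_right, real_inner_smul_right, real_inner_smul_left,
      real_inner_comm (U y), real_inner_comm (J y)]
    ring
  have i12 : Integrable (fun y => gaussWeight y * f y * g₁ y - gaussWeight y * f y * g₂ y) := i1.sub i2
  have i123 : Integrable (fun y => (gaussWeight y * f y * g₁ y - gaussWeight y * f y * g₂ y) -
      gaussWeight y * f y * g₃ y) := i12.sub i3
  rw [st, integral_add i123 i4, integral_sub i12 i3, integral_sub i1 i2]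
  linarith

/-- **Interior regularity, rotating gauge** (Hörmander 1967, Thm. 1.1, through the tree's
`hormander1967_thm11_proof`, with the smooth drift `X₀ = ½y + U − Jy`): a locally integrable
distributional solution `u` of `Δu + div(u(½y + U − Jy)) = 0` agrees a.e. with a smooth
function. [cite: Hormander1967, Thm 1.1] -/
theorem exists_contDiff_ae_eq_rot (h : DriftHyp U C₀) (J : E →L[ℝ] E) {u : E → ℝ}
    (hu : LocallyIntegrable u volume)
    (hdist : ∀ φ : E → ℝ, ContDiff ℝ ∞ φ → HasCompactSupport φ →
      ∫ y, u y * ((Δ φ) y - fderiv ℝ φ y ((1 / 2 : ℝ) • y + U y - J y)) = 0) :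
    ∃ w : E → ℝ, ContDiff ℝ ∞ w ∧ u =ᵐ[volume] w := by
  set X₀ : E → E := fun y => (1 / 2 : ℝ) • y + U y - J y with hX₀def
  have hX₀ : ContDiff ℝ ∞ X₀ := ((contDiff_id.const_smul (1 / 2 : ℝ)).add h.contDiff).sub J.contDiff
  set b := stdOrthonormalBasis ℝ E with hb
  set X : Fin (Module.finrank ℝ E) → E → E := fun j _ => b j with hX
  set c : E → ℝ := fieldDiv X₀ with hcdef
  have hc : ContDiff ℝ ∞ c := contDiff_fieldDiv hX₀
  have hhyp : IsHypoellipticOn (⊤ : Opens E) (hormanderTranspose X₀ X c) volume :=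
    Literature.Analysis.Hypoelliptic.hormander1967_thm11_proof E volume (Fin (Module.finrank ℝ E)) ⊤ X₀ X c
      hX₀ (fun _ => contDiff_const) hc (isBracketGenerating_frame b X₀ _)
  have huU : LocallyIntegrableOn u ((⊤ : Opens E) : Set E) volume := hu.locallyIntegrableOn _
  let uD : 𝓓'((⊤ : Opens E), ℝ) :=
    (TestFunction.integralAgainstBilinCLM (ContinuousLinearMap.mul ℝ ℝ) volume u : 𝓓((⊤ : Opens E), ℝ) →L[ℝ] ℝ)
  have huD : ∀ φ : 𝓓((⊤ : Opens E), ℝ), uD φ = ∫ x, φ x * u x := by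
    intro φ
    change TestFunction.integralAgainstBilinCLM (ContinuousLinearMap.mul ℝ ℝ) volume u φ = _
    rw [TestFunction.integralAgainstBilinCLM_eq_integral huU]
    simp
  have himg : ImageIsSmoothOn uD (hormanderTranspose X₀ X c) volume Set.univ := by
    refine ⟨fun _ => 0, contDiffOn_const, fun φ ψ _ hψ => ?_⟩
    rw [huD ψ]
    simp only [zero_mul, integral_zero]
    have hφ2 : ContDiff ℝ 2 (φ : E → ℝ) := φ.contDiff.of_le (by norm_cast)
    calc ∫ x, ψ x * u x = ∫ y, u y * ((Δ (φ : E → ℝ)) y - fderiv ℝ (φ : E → ℝ) y ((1 / 2 : ℝ) • y + U y - J y)) := by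
          refine integral_congr_ae (Eventually.of_forall fun y => ?_)
          dsimp only
          rw [hψ, hX, hcdef, hormanderTranspose_frame_eq b hφ2 y, mul_comm]
      _ = 0 := hdist φ φ.contDiff φ.hasCompactSupport
  obtain ⟨w, hw, hwint⟩ := hhyp uD Set.univ isOpen_univ (fun _ _ => trivial) himg
  refine ⟨w, contDiffOn_univ.1 hw, ?_⟩
  have hwli : LocallyIntegrable w volume := (contDiffOn_univ.1 hw).continuous.locallyIntegrable
  refine ae_eq_of_integral_contDiff_smul_eq hu hwli fun g hg hgc => ?_
  have h1 := hwint (mkTest g hg hgc) (Set.subset_univ _)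
  rw [huD] at h1
  simp only [coe_mkTest] at h1
  simp only [smul_eq_mul]
  rw [h1]
  exact integral_congr_ae (Eventually.of_forall fun x => mul_comm _ _)

/-- **A smooth nonzero solution with finite Gaussian energy, rotating gauge.** Under `DriftHyp U C₀`
and for a skew continuous linear `J` there is `v ∈ C^∞(E)`, not identically zero, with
`v, ∇v ∈ L²(γ)`, `γ|y|²v²` integrable (Hardy), and
`Δ(γv) + div(γv (½y + U − Jy)) = 0` pointwise — `w = γ v` is a classical solution of the adjoint
rotating-frame equation `Δw + div(w (U + ½y − Jy)) = 0` (Pineau–Vicol 2026, (5.1)–(5.2), in the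
rotating gauge; Lax–Milgram + Rellich + Fredholm + Hörmander). [cite: PineauVicol2026, Prop. 5.1 / (5.2)] -/
theorem exists_smooth_solution_rot (h : DriftHyp U C₀) {J : E →L[ℝ] E} (hJ : ∀ v, ⟪J v, v⟫ = 0) :
    ∃ v : E → ℝ, ContDiff ℝ ∞ v ∧ MemLp v 2 (gaussMeasure (E := E)) ∧
      MemLp (gradient v) 2 (gaussMeasure (E := E)) ∧
      Integrable (fun y => gaussWeight y * (‖y‖ ^ 2 * v y ^ 2)) ∧ (∃ y, v y ≠ 0) ∧
      ∀ y, (Δ (fun z => gaussWeight z * v z)) y +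
        VectorCalculus.divergence (fun z => (gaussWeight z * v z) • ((1 / 2 : ℝ) • z + U z - J z)) y = 0 := by
  obtain ⟨f, G, hf, hG, hf0, hgrad, hhardy, hweak⟩ := exists_weak_solution_fun_rot h hJ
  have hdist := integral_mul_transpose_eq_zero_rot h hJ hf hgrad hweak
  have hu : LocallyIntegrable (fun y => gaussWeight y * f y) volume :=
    (integrable_gaussWeight_mul_of_memLp hf).locallyIntegrable
  obtain ⟨w, hw, huw⟩ := exists_contDiff_ae_eq_rot h J hu hdist
  set v : E → ℝ := fun y => w y / gaussWeight y with hv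
  have hvs : ContDiff ℝ ∞ v := hw.div contDiff_gaussWeight fun y => (gaussWeight_pos y).ne'
  have hwv : ∀ y, gaussWeight y * v y = w y := fun y => by
    simp only [hv]
    field_simp [(gaussWeight_pos y).ne']
  have hfv : f =ᵐ[volume] v := by
    filter_upwards [huw] with y hy
    simp only [hv]
    rw [← hy]
    field_simp [(gaussWeight_pos y).ne']
  have hv2 : MemLp v 2 (gaussMeasure (E := E)) := hf.ae_eq (gaussMeasure_absolutelyContinuous.ae_le hfv)
  -- classical equation for `w = γ v`
  have hXs : ContDiff ℝ ∞ (fun y : E => (1 / 2 : ℝ) • y + U y - J y) :=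
    ((contDiff_id.const_smul (1 / 2 : ℝ)).add h.contDiff).sub J.contDiff
  have hdistw : ∀ φ : E → ℝ, ContDiff ℝ ∞ φ → HasCompactSupport φ →
      ∫ y, w y * ((Δ φ) y - fderiv ℝ φ y ((1 / 2 : ℝ) • y + U y - J y)) = 0 := by
    intro φ hφ hφc
    rw [← hdist φ hφ hφc]
    refine integral_congr_ae ?_
    filter_upwards [huw] with y hy
    rw [hy]
  have hcl := laplacian_add_divergence_eq_zero_of_distributional hw hXs hdistw
  have hw_eq : w = fun z => gaussWeight z * v z := funext fun z => (hwv z).symm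
  -- gradient
  have hgv := gradient_ae_eq_of_weakGradient (hvs.of_le (by norm_cast)) hfv hG hgrad
  have hG2 : MemLp (gradient v) 2 (gaussMeasure (E := E)) :=
    hG.ae_eq (gaussMeasure_absolutelyContinuous.ae_le hgv.symm)
  -- Hardy
  have hhardy' : Integrable (fun y => gaussWeight y * (‖y‖ ^ 2 * v y ^ 2)) := by
    refine hhardy.congr ?_
    filter_upwards [hfv] with y hy
    rw [hy]
  -- nonzero
  have hne : ∃ y, v y ≠ 0 := by
    by_contra hall
    push Not at hall
    apply hf0
    filter_upwards [hfv] with y hy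
    rw [hy, hall y, Pi.zero_apply]
  refine ⟨v, hvs, hv2, hG2, hhardy', hne, fun y => ?_⟩
  have := hcl y
  rw [hw_eq] at this
  exact this

/-- **Registered form (B2 tool stub `rotatingDensity_smoothSolution`, physical space `ℝ³`,
`J = α • rotGenL`).** For a smooth bounded divergence-free drift `U` on `ℝ³` (`DriftHyp U C₀`) and
any angular speed `α`: a smooth `v ≢ 0` with `v, ∇v ∈ L²(γ)`, `γ|y|²v²` integrable, such that
`w = γ v` solves the adjoint rotating-frame equation `Δw + div(w (U + ½y − α rotGen y)) = 0`
classically. [cite: PineauVicol2026, Prop. 5.1 / (5.2) and Remark 5.2] -/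
theorem rotatingDensity_smoothSolution :
    ∀ (U : EuclideanSpace ℝ (Fin 3) → EuclideanSpace ℝ (Fin 3)) (C₀ α : ℝ), Literature.Analysis.FluidPDE.PineauVicol2026.DriftHyp U C₀ → ∃ v : EuclideanSpace ℝ (Fin 3) → ℝ, ContDiff ℝ (⊤ : ℕ∞) v ∧ MeasureTheory.MemLp v 2 (Literature.Analysis.FluidPDE.PineauVicol2026.gaussMeasure (E := EuclideanSpace ℝ (Fin 3))) ∧ MeasureTheory.MemLp (gradient v) 2 (Literature.Analysis.FluidPDE.PineauVicol2026.gaussMeasure (E := EuclideanSpace ℝ (Fin 3))) ∧ MeasureTheory.Integrable (fun y => Literature.Analysis.FluidPDE.PineauVicol2026.gaussWeight y * (‖y‖ ^ 2 * v y ^ 2)) ∧ (∃ y, v y ≠ 0) ∧ ∀ y : EuclideanSpace ℝ (Fin 3), Laplacian.laplacian (fun z => Literature.Analysis.FluidPDE.PineauVicol2026.gaussWeight z * v z) y + Literature.Analysis.FluidPDE.VectorCalculus.divergence (fun z => (Literature.Analysis.FluidPDE.PineauVicol2026.gaussWeight z * v z) • ((1 / 2 : ℝ) • z + U z - α • Literature.Analysis.FluidPDE.rotGen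 z)) y = 0 := by
  intro U C₀ α h
  have hJ : ∀ v : EuclideanSpace ℝ (Fin 3), ⟪(α • rotGenL) v, v⟫ = 0 := fun v => by
    rw [_root_.FunLike.coe_smul, Pi.smul_apply, rotGenL_apply, real_inner_smul_left, inner_rotGen_self, mul_zero]
  obtain ⟨v, hv, hv2, hG2, hh, hne, heq⟩ := exists_smooth_solution_rot h hJ
  refine ⟨v, hv, hv2, hG2, hh, hne, fun y => ?_⟩
  have e : (fun z : EuclideanSpace ℝ (Fin 3) => (gaussWeight z * v z) • ((1 / 2 : ℝ) • z + U z - α • rotGen z)) =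
      fun z => (gaussWeight z * v z) • ((1 / 2 : ℝ) • z + U z - (α • rotGenL) z) := by
    funext z
    rw [_root_.FunLike.coe_smul, Pi.smul_apply, rotGenL_apply]
  rw [e]
  exact heq y

end Summit.NavierStokesRegularity.NavierStokesRegularity.Theorems
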